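import Literature.AlgebraicGeometry.GroupSchemes.StrictBirationalGroupLaw
import Mathlib.AlgebraicGeometry.Geometrically.Irreducible
import Mathlib.AlgebraicGeometry.PullbackCarrier
import HarnessLib

/-!
# «`(x·a₀, b₀) ∈ dom` for a generic `x`»: the translated law is defined generically over every point
# (Artin, *Néron models*, §2, proof of Lemma 2.3)

Topic `Literature/AlgebraicGeometry/GroupSchemes`, namespace `Literature.AlgebraicGeometry.GroupSchemes`.
THEOREMS ONLY (no definition, no named fact, no instance, no `sorry`).  Cell `hodgecm-mathlib` (D-0151), road W
(Néron capital), node W1b-β (the three projections of the graph closure of a strict birational group law).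

Artin's proof of Lemma 2.3 ([Artin1986NeronModels] p. 222) takes `(a, b, c), (a, b, c′)` in the graph closure and a
section `x` «generic», and uses that `xa`, `(xa)b` and `xc` are all defined.  For SCHEME points `a, b` of `V` the
middle condition — «`(x·a, b)` lies in the domain `dom` of the law» — is a statement about the point `(x, (a, b))` of
`V ×_S (V ×_S V)` over the point `p₀ = (a, b)` of `V ×_S V`; by the bridge
`GroupSchemes.exists_open_forall_section_lift_mem` (`SectionsThroughFibreDenseOpens.lean`) it is available for the
sections through some open meeting the fibre `V_s` as soon as the open

  `O₂ = {(v, (a, b)) : (v, a) ∈ dom ∧ (v·a, b) ∈ dom} ⊆ V ×_S (V ×_S V)`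

is DENSE IN THE FIBRE of `pr₂ : V ×_S (V ×_S V) ⟶ V ×_S V` over `p₀`.  This file proves that density
(`BirationalGroupLaw.fibre_subset_closure_translateDom`) for a STRICT law on `𝒳 → S` universally open with
geometrically irreducible fibres: the fibre `F` over `p₀` is irreducible, its generic point `ζ` maps under
`α = (v, (a, b)) ↦ (v, a)` (a base change, so `α(F)` is the whole `pr₂`-fibre of `V ×_S V` over `a`) to the generic
point of that fibre, which lies in the dense open `dom ∩ pr₂⁻¹(a)` (strictness); and `Θ = (v, a, b) ↦ (v·a, b)` is the
base change `Ψ × id` of the right shear (an open immersion preserving `F`) followed by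
`β = (u, (a, b)) ↦ (u, b)` (again a base change, mapping `F` onto the fibre over `b`), so `Θ(ζ)` is the generic point
of `pr₂⁻¹(b)`, again in `dom` by strictness.  Banked leaf; no floor change.

## References
* [Artin1986NeronModels] M. Artin, *Néron models*, in Cornell–Silverman (eds.), *Arithmetic Geometry*, Springer
  1986, §2, Lemma 2.3 and its proof (p. 222), and (2.2) (p. 221).
* [EdixhovenRomagny] B. Edixhoven, M. Romagny, *Group schemes out of birational group laws, Néron models*, Panor.
  Synthèses 47 (2015), Def. 3.4 (2) (strictness on `T`-points).
-/

set_option autoImplicit false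

noncomputable section

namespace Literature.AlgebraicGeometry.GroupSchemes

open CategoryTheory CategoryTheory.Limits _root_.AlgebraicGeometry MonoidalCategory CartesianMonoidalCategory
open TopologicalSpace Topology
open scoped CategoryTheory.Obj

universe u

variable {S : Scheme.{u}} {𝒳 : Over S}

/-! ## §1. Generic points of fibres -/

/-- A point `ζ` of an irreducible fibre `h⁻¹(y)` which is generic in it: `ζ ∈ h⁻¹(y)` and
`h⁻¹(y) ⊆ closure {ζ}` (the generic point of the closure of the fibre lies in the fibre, schemes being `T₀`).
[folklore] -/
private theorem exists_generic_of_isIrreducible_fibre {W P : Scheme.{u}} (h : W ⟶ P) (y : P)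
    (hirr : IsIrreducible (h ⁻¹' {y})) : ∃ ζ : W, h ζ = y ∧ h ⁻¹' {y} ⊆ closure {ζ} := by
  set Z : Set W := h ⁻¹' {y} with hZ
  have hgen : IsGenericPoint hirr.genericPoint (closure Z) := hirr.isGenericPoint_genericPoint_closure
  set ζ := hirr.genericPoint with hζ
  have hZsub : Z ⊆ closure {ζ} := by rw [hgen]; exact subset_closure
  refine ⟨ζ, ?_, hZsub⟩
  -- `h ζ` specialises to `y` and `y` specialises to `h ζ`
  have hζcl : ζ ∈ closure Z := by rw [← hgen]; exact subset_closure (Set.mem_singleton ζ)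
  have h1 : h ζ ∈ closure {y} := by
    have : h '' closure Z ⊆ closure (h '' Z) := image_closure_subset_closure_image h.continuous
    have hy : h '' Z ⊆ {y} := by rintro _ ⟨w, hw, rfl⟩; exact hw
    exact closure_mono hy (this ⟨ζ, hζcl, rfl⟩)
  obtain ⟨z, hz⟩ := hirr.nonempty
  have h2 : y ∈ closure {h ζ} := by
    have hz' : z ∈ closure {ζ} := hZsub hz
    have : h z ∈ closure {h ζ} := by
      have := image_closure_subset_closure_image h.continuous ⟨z, hz', rfl⟩
      rwa [Set.image_singleton] at this
    rw [show h z = y from hz] at this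
    exact this
  have hs1 : h ζ ⤳ y := specializes_iff_mem_closure.mpr h2
  have hs2 : y ⤳ h ζ := specializes_iff_mem_closure.mpr h1
  exact (hs1.antisymm hs2).eq

/-- A point generic in a set lies in every open set meeting it. [folklore] -/
private theorem mem_of_isOpen_of_inter_nonempty {W : Scheme.{u}} {Z : Set W} {ζ : W} (hZ : Z ⊆ closure {ζ})
    {O : Set W} (hO : IsOpen O) (hne : (O ∩ Z).Nonempty) : ζ ∈ O := by
  obtain ⟨w, hwO, hwZ⟩ := hne
  have hw : w ∈ closure ({ζ} : Set W) := hZ hwZ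
  rw [mem_closure_iff] at hw
  obtain ⟨_, h1, rfl⟩ := hw O hO hwO
  exact h1

/-- If a morphism maps a set `Z`, generic point `ζ`, ONTO a set `Z'`, then `Z' ⊆ closure {f ζ}`. [folklore] -/
private theorem subset_closure_image_of_surjOn {W P : Scheme.{u}} (f : W ⟶ P) {Z : Set W} {ζ : W}
    (hZ : Z ⊆ closure {ζ}) {Z' : Set P} (hsurj : Z' ⊆ f '' Z) : Z' ⊆ closure {f ζ} := by
  intro z' hz'
  obtain ⟨z, hz, rfl⟩ := hsurj hz'
  have := image_closure_subset_closure_image f.continuous ⟨z, hZ hz, rfl⟩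
  rwa [Set.image_singleton] at this

/-! ## §2. The maps `α = (v,(a,b)) ↦ (v,a)` and `β = (u,(a,b)) ↦ (u,b)` are base changes -/

section AlphaBeta

variable (𝒳)

/-- A morphism `α : V ×_S (V ×_S V) ⟶ V ×_S V` with coordinates `(v, (a, b)) ↦ (v, a)` is a base change: the square
with the second projections over `fst : V ×_S V ⟶ V` is cartesian. [folklore] -/
private theorem isPullback_of_coord_fst (α : pullback 𝒳.hom (𝒳 ⊗ 𝒳).hom ⟶ (𝒳 ⊗ 𝒳).left)
    (h1 : α ≫ (fst 𝒳 𝒳).left = pullback.fst 𝒳.hom (𝒳 ⊗ 𝒳).hom)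
    (h2 : α ≫ (snd 𝒳 𝒳).left = pullback.snd 𝒳.hom (𝒳 ⊗ 𝒳).hom ≫ (fst 𝒳 𝒳).left) :
    IsPullback α (pullback.snd 𝒳.hom (𝒳 ⊗ 𝒳).hom) (snd 𝒳 𝒳).left (fst 𝒳 𝒳).left := by
  have big : IsPullback (α ≫ (fst 𝒳 𝒳).left) (pullback.snd 𝒳.hom (𝒳 ⊗ 𝒳).hom) 𝒳.hom
      ((fst 𝒳 𝒳).left ≫ 𝒳.hom) := by
    rw [h1]
    exact IsPullback.of_hasPullback 𝒳.hom (𝒳 ⊗ 𝒳).hom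
  exact IsPullback.of_right big h2 (IsPullback.of_hasPullback 𝒳.hom 𝒳.hom)

/-- A morphism `β : V ×_S (V ×_S V) ⟶ V ×_S V` with coordinates `(u, (a, b)) ↦ (u, b)` is a base change: the square
with the second projections over `snd : V ×_S V ⟶ V` is cartesian. [folklore] -/
private theorem isPullback_of_coord_snd (β : pullback 𝒳.hom (𝒳 ⊗ 𝒳).hom ⟶ (𝒳 ⊗ 𝒳).left)
    (h1 : β ≫ (fst 𝒳 𝒳).left = pullback.fst 𝒳.hom (𝒳 ⊗ 𝒳).hom)
    (h2 : β ≫ (snd 𝒳 𝒳).left = pullback.snd 𝒳.hom (𝒳 ⊗ 𝒳).hom ≫ (snd 𝒳 𝒳).left) :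
    IsPullback β (pullback.snd 𝒳.hom (𝒳 ⊗ 𝒳).hom) (snd 𝒳 𝒳).left (snd 𝒳 𝒳).left := by
  have hw : (𝒳 ⊗ 𝒳).hom = (snd 𝒳 𝒳).left ≫ 𝒳.hom := (Over.w (snd 𝒳 𝒳)).symm
  have big : IsPullback (β ≫ (fst 𝒳 𝒳).left) (pullback.snd 𝒳.hom (𝒳 ⊗ 𝒳).hom) 𝒳.hom
      ((snd 𝒳 𝒳).left ≫ 𝒳.hom) := by
    rw [h1, ← hw]
    exact IsPullback.of_hasPullback 𝒳.hom (𝒳 ⊗ 𝒳).hom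
  exact IsPullback.of_right big h2 (IsPullback.of_hasPullback 𝒳.hom 𝒳.hom)

end AlphaBeta

/-! ## §3. The translated law is defined generically over every point -/

namespace BirationalGroupLaw

variable (L : BirationalGroupLaw 𝒳)

/-- **Density of «`va` and `(va)b` defined» in the fibre over a point `(a, b)`** ([Artin1986NeronModels] §2, proof of
Lemma 2.3, for scheme points).  Let `L` be a STRICT birational group law on `𝒳 → S` universally open with
geometrically irreducible fibres.  Let `W = V ×_S (V ×_S V)` (Mathlib `pullback 𝒳.hom (𝒳 ⊗ 𝒳).hom`),
`α : W → V ×_S V` the morphism with coordinates `(v,(a,b)) ↦ (v,a)`, `A = α⁻¹ dom`, and `Θ : A → V ×_S V` the morphism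
with coordinates `(v,a,b) ↦ (v·a, b)` (both characterised by their coordinates).  Then for every point `p₀` of
`V ×_S V` the open `{w ∈ A : Θ w ∈ dom}` is dense in the fibre of `pr₂ : W → V ×_S V` over `p₀` — the shape consumed by
`GroupSchemes.exists_open_forall_section_lift_mem`.
[cite: Artin1986NeronModels, §2, proof of Lemma 2.3 (p. 222) and (2.2) (p. 221)] [cite: EdixhovenRomagny, Def. 3.4 (2)] -/
theorem fibre_subset_closure_translateDom [UniversallyOpen 𝒳.hom] [GeometricallyIrreducible 𝒳.hom]
    (hL : L.IsStrict) (α : pullback 𝒳.hom (𝒳 ⊗ 𝒳).hom ⟶ (𝒳 ⊗ 𝒳).left)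
    (hα₁ : α ≫ (fst 𝒳 𝒳).left = pullback.fst 𝒳.hom (𝒳 ⊗ 𝒳).hom)
    (hα₂ : α ≫ (snd 𝒳 𝒳).left = pullback.snd 𝒳.hom (𝒳 ⊗ 𝒳).hom ≫ (fst 𝒳 𝒳).left)
    (Θ : ((α ⁻¹ᵁ L.dom : (pullback 𝒳.hom (𝒳 ⊗ 𝒳).hom).Opens) : Scheme.{u}) ⟶ (𝒳 ⊗ 𝒳).left)
    (hΘ₁ : Θ ≫ (fst 𝒳 𝒳).left = (α ∣_ L.dom) ≫ L.mul)
    (hΘ₂ : Θ ≫ (snd 𝒳 𝒳).left = (α ⁻¹ᵁ L.dom).ι ≫ pullback.snd 𝒳.hom (𝒳 ⊗ 𝒳).hom ≫ (snd 𝒳 𝒳).left)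
    (p₀ : ↑(𝒳 ⊗ 𝒳).left) :
    (pullback.snd 𝒳.hom (𝒳 ⊗ 𝒳).hom) ⁻¹' {p₀} ⊆
      closure ((((α ⁻¹ᵁ L.dom).ι ''ᵁ (Θ ⁻¹ᵁ L.dom) : (pullback 𝒳.hom (𝒳 ⊗ 𝒳).hom).Opens) :
          Set ↑(pullback 𝒳.hom (𝒳 ⊗ 𝒳).hom)) ∩ (pullback.snd 𝒳.hom (𝒳 ⊗ 𝒳).hom) ⁻¹' {p₀}) := by
  -- notation: the right shear `Ψ'`, retyped on `↑dom`
  let Ψ' : (L.dom : Scheme.{u}) ⟶ (𝒳 ⊗ 𝒳).left := L.shearRight.left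
  haveI hΨo : IsOpenImmersion Ψ' := L.isOpenImmersion_shearRight
  have hΨ1 : Ψ' ≫ (fst 𝒳 𝒳).left = L.mul :=
    congrArg CommaMorphism.left (LawData.shearRight_fst 𝒳 L.dom L.mul L.mul_comp)
  have hΨ2 : Ψ' ≫ (snd 𝒳 𝒳).left = L.dom.ι ≫ (snd 𝒳 𝒳).left :=
    congrArg CommaMorphism.left (LawData.shearRight_snd 𝒳 L.dom L.mul L.mul_comp)
  have hres : (α ∣_ L.dom) ≫ L.dom.ι = (α ⁻¹ᵁ L.dom).ι ≫ α := morphismRestrict_ι _ _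
  intro w hw
  -- the fibre `F` over `p₀` is irreducible; take a point `ζ` generic in it
  have hirrF : IsIrreducible ((pullback.snd 𝒳.hom (𝒳 ⊗ 𝒳).hom) ⁻¹' {p₀}) :=
    (pullback.snd 𝒳.hom (𝒳 ⊗ 𝒳).hom).isIrreducible_preimage (pullback.snd 𝒳.hom (𝒳 ⊗ 𝒳).hom).isOpenMap isIrreducible_singleton
  obtain ⟨ζ, hζy, hζgen⟩ := exists_generic_of_isIrreducible_fibre (pullback.snd 𝒳.hom (𝒳 ⊗ 𝒳).hom) p₀ hirrF
  -- it suffices to show `ζ ∈ O₂`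
  suffices hζO : ζ ∈ (((α ⁻¹ᵁ L.dom).ι ''ᵁ (Θ ⁻¹ᵁ L.dom) : (pullback 𝒳.hom (𝒳 ⊗ 𝒳).hom).Opens) :
      Set ↑(pullback 𝒳.hom (𝒳 ⊗ 𝒳).hom)) by
    have hmem : ζ ∈ (((α ⁻¹ᵁ L.dom).ι ''ᵁ (Θ ⁻¹ᵁ L.dom) : (pullback 𝒳.hom (𝒳 ⊗ 𝒳).hom).Opens) :
        Set ↑(pullback 𝒳.hom (𝒳 ⊗ 𝒳).hom)) ∩ (pullback.snd 𝒳.hom (𝒳 ⊗ 𝒳).hom) ⁻¹' {p₀} := ⟨hζO, hζy⟩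
    exact closure_mono (Set.singleton_subset_iff.mpr hmem) (hζgen hw)
  -- (1) `α ζ` is generic in the `snd`-fibre of `V ×_S V` over `a₀ = fst p₀`, hence lies in `dom`
  have hαpb := isPullback_of_coord_fst 𝒳 α hα₁ hα₂
  have hαζ_snd : (snd 𝒳 𝒳).left (α ζ) = (fst 𝒳 𝒳).left p₀ := by
    change (α ≫ (snd 𝒳 𝒳).left) ζ = _
    rw [hα₂]
    change (fst 𝒳 𝒳).left ((pullback.snd 𝒳.hom (𝒳 ⊗ 𝒳).hom) ζ) = _
    rw [hζy]
  have hGa : (snd 𝒳 𝒳).left ⁻¹' {(fst 𝒳 𝒳).left p₀} ⊆ closure {α ζ} := by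
    refine subset_closure_image_of_surjOn α hζgen fun d hd => ?_
    obtain ⟨w', hw'1, hw'2⟩ := Scheme.exists_preimage_of_isPullback hαpb d p₀ hd
    exact ⟨w', hw'2, hw'1⟩
  have hαζ : α ζ ∈ L.dom := by
    obtain ⟨⟨-, hdsnd⟩, -, -⟩ := hL
    exact mem_of_isOpen_of_inter_nonempty hGa L.dom.2 (hdsnd.nonempty_inter_fibre ⟨α ζ, hαζ_snd⟩)
  have hζA : ζ ∈ α ⁻¹ᵁ L.dom := hαζ
  obtain ⟨ζA, hζA'⟩ : ζ ∈ Set.range (α ⁻¹ᵁ L.dom).ι := by rw [Scheme.Opens.range_ι]; exact hζA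
  -- (2) `Θ ζA` is generic in the `snd`-fibre over `b₀ = snd p₀`: write `Θ = Ψ₃ ≫ β'`
  -- the morphism `Ψ₃ : A ⟶ W`, `(v, a, b) ↦ (va, (a, b))`
  have hw3 : ((α ∣_ L.dom) ≫ L.mul) ≫ 𝒳.hom = ((α ⁻¹ᵁ L.dom).ι ≫ (pullback.snd 𝒳.hom (𝒳 ⊗ 𝒳).hom)) ≫ (𝒳 ⊗ 𝒳).hom := by
    rw [Category.assoc, L.mul_comp, ← Category.assoc, hres, Category.assoc, Category.assoc,
      ← pullback.condition, ← reassoc_of% hα₁]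
    rfl
  let Ψ₃ : ((α ⁻¹ᵁ L.dom : (pullback 𝒳.hom (𝒳 ⊗ 𝒳).hom).Opens) : Scheme.{u}) ⟶
      pullback 𝒳.hom (𝒳 ⊗ 𝒳).hom :=
    pullback.lift ((α ∣_ L.dom) ≫ L.mul) ((α ⁻¹ᵁ L.dom).ι ≫ (pullback.snd 𝒳.hom (𝒳 ⊗ 𝒳).hom)) hw3
  have hΨ₃1 : Ψ₃ ≫ pullback.fst 𝒳.hom (𝒳 ⊗ 𝒳).hom = (α ∣_ L.dom) ≫ L.mul := pullback.lift_fst _ _ _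
  have hΨ₃2 : Ψ₃ ≫ (pullback.snd 𝒳.hom (𝒳 ⊗ 𝒳).hom) = (α ⁻¹ᵁ L.dom).ι ≫ (pullback.snd 𝒳.hom (𝒳 ⊗ 𝒳).hom) := pullback.lift_snd _ _ _
  -- the square `A —Ψ₃→ W —α→ V ×_S V ← Ψ — dom ← α| — A` is cartesian, so `Ψ₃` is an open immersion
  have hsq : Ψ₃ ≫ α = (α ∣_ L.dom) ≫ Ψ' := by
    apply pullback.hom_ext
    · change (Ψ₃ ≫ α) ≫ (fst 𝒳 𝒳).left = ((α ∣_ L.dom) ≫ Ψ') ≫ (fst 𝒳 𝒳).left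
      rw [Category.assoc, hα₁, hΨ₃1, Category.assoc, hΨ1]
    · change (Ψ₃ ≫ α) ≫ (snd 𝒳 𝒳).left = ((α ∣_ L.dom) ≫ Ψ') ≫ (snd 𝒳 𝒳).left
      rw [Category.assoc, hα₂, reassoc_of% hΨ₃2, Category.assoc, hΨ2, reassoc_of% hres, hα₂]
  -- cone data
  have hcone : ∀ t : PullbackCone α Ψ',
      (t.snd ≫ L.dom.ι ≫ (fst 𝒳 𝒳).left) ≫ 𝒳.hom = (t.fst ≫ (pullback.snd 𝒳.hom (𝒳 ⊗ 𝒳).hom)) ≫ (𝒳 ⊗ 𝒳).hom := fun t => by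
    have h := congrArg (· ≫ (fst 𝒳 𝒳).left ≫ 𝒳.hom) t.condition
    simp only [Category.assoc, reassoc_of% hΨ1] at h
    rw [reassoc_of% hα₁, pullback.condition] at h
    rw [Category.assoc, Category.assoc, Over.w (fst 𝒳 𝒳), ← L.mul_comp, Category.assoc]
    exact h.symm
  have hconeα : ∀ t : PullbackCone α Ψ',
      pullback.lift (t.snd ≫ L.dom.ι ≫ (fst 𝒳 𝒳).left) (t.fst ≫ (pullback.snd 𝒳.hom (𝒳 ⊗ 𝒳).hom)) (hcone t) ≫ α = t.snd ≫ L.dom.ι :=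
    fun t => by
    have h2 := congrArg (· ≫ (snd 𝒳 𝒳).left) t.condition
    simp only [Category.assoc, hα₂, hΨ2] at h2
    apply pullback.hom_ext
    · change (_ ≫ α) ≫ (fst 𝒳 𝒳).left = (t.snd ≫ L.dom.ι) ≫ (fst 𝒳 𝒳).left
      rw [Category.assoc, hα₁, pullback.lift_fst, Category.assoc]
    · have e3 : pullback.lift (t.snd ≫ L.dom.ι ≫ (fst 𝒳 𝒳).left) (t.fst ≫ (pullback.snd 𝒳.hom (𝒳 ⊗ 𝒳).hom))
          (hcone t) ≫ (pullback.snd 𝒳.hom (𝒳 ⊗ 𝒳).hom) = t.fst ≫ (pullback.snd 𝒳.hom (𝒳 ⊗ 𝒳).hom) :=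
        pullback.lift_snd _ _ _
      change (_ ≫ α) ≫ (snd 𝒳 𝒳).left = (t.snd ≫ L.dom.ι) ≫ (snd 𝒳 𝒳).left
      rw [Category.assoc, hα₂, reassoc_of% e3, Category.assoc]
      exact h2
  have hconeRange : ∀ t : PullbackCone α Ψ',
      Set.range (pullback.lift (t.snd ≫ L.dom.ι ≫ (fst 𝒳 𝒳).left) (t.fst ≫ (pullback.snd 𝒳.hom (𝒳 ⊗ 𝒳).hom)) (hcone t)) ⊆
        Set.range (α ⁻¹ᵁ L.dom).ι := fun t => by
    rintro _ ⟨x, rfl⟩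
    rw [Scheme.Opens.range_ι]
    change (pullback.lift (t.snd ≫ L.dom.ι ≫ (fst 𝒳 𝒳).left) (t.fst ≫ (pullback.snd 𝒳.hom (𝒳 ⊗ 𝒳).hom)) (hcone t) ≫ α) x ∈ L.dom
    rw [hconeα]
    change L.dom.ι (t.snd x) ∈ L.dom
    rw [← SetLike.mem_coe, ← Scheme.Opens.range_ι]
    exact ⟨_, rfl⟩
  have hpb : IsPullback Ψ₃ (α ∣_ L.dom) α Ψ' := by
    refine IsPullback.of_isLimit' ⟨hsq⟩ (PullbackCone.IsLimit.mk hsq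
      (fun t => IsOpenImmersion.lift (α ⁻¹ᵁ L.dom).ι _ (hconeRange t))
      (fun t => ?_) (fun t => ?_) (fun t m hm₁ hm₂ => ?_))
    · -- `lift ≫ Ψ₃ = t.fst`
      have e1 : IsOpenImmersion.lift (α ⁻¹ᵁ L.dom).ι _ (hconeRange t) ≫ (α ∣_ L.dom) = t.snd := by
        rw [← cancel_mono L.dom.ι, Category.assoc, hres, ← Category.assoc, IsOpenImmersion.lift_fac]
        exact hconeα t
      have h := congrArg (· ≫ (fst 𝒳 𝒳).left) t.condition
      simp only [Category.assoc, hα₁, hΨ1] at h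
      apply pullback.hom_ext
      · rw [Category.assoc, hΨ₃1, ← Category.assoc, e1]
        exact h.symm
      · rw [Category.assoc, hΨ₃2, ← Category.assoc, IsOpenImmersion.lift_fac, pullback.lift_snd]
    · -- `lift ≫ α| = t.snd`
      rw [← cancel_mono L.dom.ι, Category.assoc, hres, ← Category.assoc, IsOpenImmersion.lift_fac]
      exact hconeα t
    · -- uniqueness
      rw [← cancel_mono (α ⁻¹ᵁ L.dom).ι, IsOpenImmersion.lift_fac]
      apply pullback.hom_ext
      · rw [pullback.lift_fst, Category.assoc, ← hα₁, ← Category.assoc (α ⁻¹ᵁ L.dom).ι, ← hres,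
          Category.assoc, reassoc_of% hm₂]
      · rw [pullback.lift_snd, Category.assoc, ← hΨ₃2, ← Category.assoc, hm₁]
  have hΨ₃o : IsOpenImmersion Ψ₃ :=
    MorphismProperty.IsStableUnderBaseChange.of_isPullback (P := @IsOpenImmersion) hpb.flip hΨo
  -- `F ⊆ closure {Ψ₃ ζA}`
  have hζAF : (pullback.snd 𝒳.hom (𝒳 ⊗ 𝒳).hom) (Ψ₃ ζA) = p₀ := by
    change (Ψ₃ ≫ (pullback.snd 𝒳.hom (𝒳 ⊗ 𝒳).hom)) ζA = p₀
    rw [hΨ₃2]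
    change (pullback.snd 𝒳.hom (𝒳 ⊗ 𝒳).hom) ((α ⁻¹ᵁ L.dom).ι ζA) = p₀
    rw [hζA', hζy]
  have hFΨ : (pullback.snd 𝒳.hom (𝒳 ⊗ 𝒳).hom) ⁻¹' {p₀} ⊆ closure {Ψ₃ ζA} := by
    have hU : IsOpen (Set.range Ψ₃) := Ψ₃.isOpenEmbedding.isOpen_range
    have hne : ((pullback.snd 𝒳.hom (𝒳 ⊗ 𝒳).hom) ⁻¹' {p₀} ∩ Set.range Ψ₃).Nonempty := ⟨Ψ₃ ζA, hζAF, ζA, rfl⟩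
    refine (subset_closure_inter_of_isPreirreducible_of_isOpen hirrF.isPreirreducible hU hne).trans
      ((isClosed_closure).closure_subset_iff.mpr ?_)
    rintro _ ⟨hu, a', rfl⟩
    have ha'F : (α ⁻¹ᵁ L.dom).ι a' ∈ (pullback.snd 𝒳.hom (𝒳 ⊗ 𝒳).hom) ⁻¹' {p₀} := by
      change ((α ⁻¹ᵁ L.dom).ι ≫ (pullback.snd 𝒳.hom (𝒳 ⊗ 𝒳).hom)) a' = p₀
      rw [← hΨ₃2]
      exact hu
    have ha'cl : a' ∈ closure ({ζA} : Set ↑(α ⁻¹ᵁ L.dom)) := by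
      have h1 : (α ⁻¹ᵁ L.dom).ι a' ∈ closure {ζ} := hζgen ha'F
      rw [← hζA'] at h1
      have h2 := (α ⁻¹ᵁ L.dom).ι.isOpenEmbedding.isOpenMap.preimage_closure_eq_closure_preimage
        (α ⁻¹ᵁ L.dom).ι.continuous {(α ⁻¹ᵁ L.dom).ι ζA}
      have h3 : a' ∈ (α ⁻¹ᵁ L.dom).ι ⁻¹' closure {(α ⁻¹ᵁ L.dom).ι ζA} := h1
      rw [h2, ← Set.image_singleton, Set.preimage_image_eq _ (α ⁻¹ᵁ L.dom).ι.isOpenEmbedding.injective] at h3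
      exact h3
    have := image_closure_subset_closure_image Ψ₃.continuous ⟨a', ha'cl, rfl⟩
    rwa [Set.image_singleton] at this
  -- the morphism `β' : W ⟶ V ×_S V`, `(u, (a, b)) ↦ (u, b)`, maps `F` onto the `snd`-fibre over `b₀ = snd p₀`
  have hwβ : pullback.fst 𝒳.hom (𝒳 ⊗ 𝒳).hom ≫ 𝒳.hom = ((pullback.snd 𝒳.hom (𝒳 ⊗ 𝒳).hom) ≫ (snd 𝒳 𝒳).left) ≫ 𝒳.hom := by
    rw [Category.assoc, Over.w (snd 𝒳 𝒳), pullback.condition]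
  let β' : pullback 𝒳.hom (𝒳 ⊗ 𝒳).hom ⟶ (𝒳 ⊗ 𝒳).left :=
    pullback.lift (pullback.fst 𝒳.hom (𝒳 ⊗ 𝒳).hom) ((pullback.snd 𝒳.hom (𝒳 ⊗ 𝒳).hom) ≫ (snd 𝒳 𝒳).left) hwβ
  have hβ1 : β' ≫ (fst 𝒳 𝒳).left = pullback.fst 𝒳.hom (𝒳 ⊗ 𝒳).hom := pullback.lift_fst _ _ _
  have hβ2 : β' ≫ (snd 𝒳 𝒳).left = (pullback.snd 𝒳.hom (𝒳 ⊗ 𝒳).hom) ≫ (snd 𝒳 𝒳).left := pullback.lift_snd _ _ _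
  have hβpb := isPullback_of_coord_snd 𝒳 β' hβ1 hβ2
  have hGb : (snd 𝒳 𝒳).left ⁻¹' {(snd 𝒳 𝒳).left p₀} ⊆ closure {β' (Ψ₃ ζA)} := by
    refine subset_closure_image_of_surjOn β' hFΨ fun d hd => ?_
    obtain ⟨w', hw'1, hw'2⟩ := Scheme.exists_preimage_of_isPullback hβpb d p₀ hd
    exact ⟨w', hw'2, hw'1⟩
  -- `Θ = Ψ₃ ≫ β'`
  have hΘ : Θ = Ψ₃ ≫ β' := by
    apply pullback.hom_ext
    · change Θ ≫ (fst 𝒳 𝒳).left = (Ψ₃ ≫ β') ≫ (fst 𝒳 𝒳).left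
      rw [hΘ₁, Category.assoc, hβ1, hΨ₃1]
    · change Θ ≫ (snd 𝒳 𝒳).left = (Ψ₃ ≫ β') ≫ (snd 𝒳 𝒳).left
      rw [hΘ₂, Category.assoc, hβ2, reassoc_of% hΨ₃2]
  have hΘζ_snd : (snd 𝒳 𝒳).left (Θ ζA) = (snd 𝒳 𝒳).left p₀ := by
    change (Θ ≫ (snd 𝒳 𝒳).left) ζA = _
    rw [hΘ₂]
    change (snd 𝒳 𝒳).left ((pullback.snd 𝒳.hom (𝒳 ⊗ 𝒳).hom) ((α ⁻¹ᵁ L.dom).ι ζA)) = _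
    rw [hζA', hζy]
  have hΘζ : Θ ζA ∈ L.dom := by
    obtain ⟨⟨-, hdsnd⟩, -, -⟩ := hL
    have hG : (snd 𝒳 𝒳).left ⁻¹' {(snd 𝒳 𝒳).left p₀} ⊆ closure {Θ ζA} := by
      rw [hΘ]; exact hGb
    exact mem_of_isOpen_of_inter_nonempty hG L.dom.2 (hdsnd.nonempty_inter_fibre ⟨Θ ζA, hΘζ_snd⟩)
  -- conclude
  rw [← hζA']
  exact ⟨ζA, hΘζ, rfl⟩

end BirationalGroupLaw

end Literature.AlgebraicGeometry.GroupSchemes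

end
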